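import Summits.CriticalPhenomena.CardyFormulaZ2.Theorems.CardyMagicRigidityPinchResamplingDefsV4
import Summits.CriticalPhenomena.CardyFormulaZ2.Statement
import HarnessLib.Audit.CruxProbe

/-!
# BC2 / BC7 probes for the crux `NestingRigidity` and the two children of the certified split
# (crux-strategist r1, 2026-08-17) — run on the farm, verdict lines quoted in STRATEGY-CENSUS.md §Decomposition.

Children (s1/p1/s2 split, re-typed over the landed Theorems defs):
`BlindRigidity := MagicFormulaZ2 → MagicFormulaT → LoopLimitZ2Blind`,
`RoutingTransfer := LoopLimitZ2Blind → LoopLimitZ2EqT`.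
-/

namespace Summit.CriticalPhenomena.CardyFormulaZ2.Cruxes.NestingRigidity.ProbesR1

open Summit.CriticalPhenomena.CardyFormulaZ2.Theses.CardyMagicRigidity
open Summit.CriticalPhenomena.CardyFormulaZ2.Cruxes.NestingRigidity.PinchResampling

/-- Child 1 of the certified split (the wall). -/
def BlindRigidity : Prop := MagicFormulaZ2 → MagicFormulaT → LoopLimitZ2Blind

/-- Child 2 of the certified split (routing transfer). -/
def RoutingTransfer : Prop := LoopLimitZ2Blind → LoopLimitZ2EqT

/-- Assembly of the split (pure logic), for the record. -/
theorem nestingRigidity_of_children (h₁ : BlindRigidity) (h₂ : RoutingTransfer) : NestingRigidity :=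
  fun hZ hT ↦ h₂ (h₁ hZ hT)

/-- Soundness: child 1 is implied by the parent crux (via the landed `loopLimitZ2Blind_of_loopLimitZ2EqT`). -/
theorem blindRigidity_of_nestingRigidity (h : NestingRigidity) : BlindRigidity :=
  fun hZ hT ↦ loopLimitZ2Blind_of_loopLimitZ2EqT (h hZ hT)

/-- Soundness: child 2 is implied by the target. -/
theorem routingTransfer_of_target (hX : LoopLimitZ2EqT) : RoutingTransfer := fun _ ↦ hX

set_option h21.cruxProbe.batteryMs 90000
set_option h21.cruxProbe.totalMs 400000

-- the crux itself against the sub-problem statement (P5 both ways) and the standard batteries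
#h21_crux_probe Summit.CriticalPhenomena.CardyFormulaZ2.Theses.CardyMagicRigidity.NestingRigidity summit := CardyFormulaZ2

-- the two children against the sub-problem statement
#h21_crux_probe Summit.CriticalPhenomena.CardyFormulaZ2.Cruxes.NestingRigidity.ProbesR1.BlindRigidity summit := CardyFormulaZ2
#h21_crux_probe Summit.CriticalPhenomena.CardyFormulaZ2.Cruxes.NestingRigidity.ProbesR1.RoutingTransfer summit := CardyFormulaZ2

-- the two children against the PARENT crux (piece ↔ crux probes)
#h21_crux_probe Summit.CriticalPhenomena.CardyFormulaZ2.Cruxes.NestingRigidity.ProbesR1.BlindRigidity summit := Summit.CriticalPhenomena.CardyFormulaZ2.Theses.CardyMagicRigidity.NestingRigidity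
#h21_crux_probe Summit.CriticalPhenomena.CardyFormulaZ2.Cruxes.NestingRigidity.ProbesR1.RoutingTransfer summit := Summit.CriticalPhenomena.CardyFormulaZ2.Theses.CardyMagicRigidity.NestingRigidity

end Summit.CriticalPhenomena.CardyFormulaZ2.Cruxes.NestingRigidity.ProbesR1
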